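import Summits.BirchSwinnertonDyer.Rank1Residual.X10.KatoMuTransferThreeOfCore
import Summits.BirchSwinnertonDyer.Rank1Residual.X10.MuTransferThreeShaAnUnit
import HarnessLib

/-!
# Class X10b = N2 (`p = 3` good ordinary, `E[3]` irreducible, `ρ̄_{E,3}` NOT surjective), PER PAIR and
# FLAG-FREE through the core: Kato's two construction facts ∧ `CoreTheoremAOnClassX10b` ∧ the finite
# certificates ⟹ Miller's `BSD(E,3)` at the `3 ∤ #Ш_an` pairs, X_A3 at the certificate-closed rank-`0`
# pairs, and the literal-model RECORD shape (cell `b2b-bsdres`, unit `b2b-bsdres-x10` = N2 class lead,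
# GEN 36; TOOL — theorems only, no definition, no named fact, nothing booked)

HONEST FRAMING (run/shared/lean/b2b/bsd-rank1-residual/, verbatim in every file): the goal of the
cell is to DELETE the COMBINATION-SHAPED residual classes of the Birch–Swinnerton-Dyer formula for
ALL analytic-rank `≤ 1` elliptic curves over `ℚ` — "full BSD formula for every rank `≤ 1` curve in
class `C`" assembled STRICTLY from published theorems — so that the rank-`≤ 1` remainder becomes
exactly the CONSTRUCTION-SHAPED classes, which are TYPED (missing-input `Prop`s), NOT attempted.
This is not "finishing BSD". Class X10b (N2) keeps its label CONSTRUCTION-SHAPED / NEEDS X_A3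
(RESIDUAL-MAP §I N2); nothing is booked by this file; no census number moves.

## What (x10 GEN 36, X10-AUDIT §42; companion of `X10/KatoMuTransferThreeOfCore.lean` and
## `X10/MuTransferThreeShaAnUnit.lean`, both GEN 36)

`X10/KatoMuTransferThreeOfCore` reduced the class node `KatoMuTransferThree` to Kato's two PUBLISHED
construction facts (`Kato2004.nonempty_iwasawaH1Data`, `Kato2004.exists_divisibilityInputs_fineQuotient_zeta`)
and ONE typed core `CoreTheoremAOnClassX10b` (the `p = 3` twin of the registered `stub_coreX9` of K6's
crux `MuTransferX9`). `X10/MuTransferThreeShaAnUnit` gave, per pair with `ord₃ #Ш_an = 0`, Miller's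
`BSD(E,3)` from `KatoMuTransferThree` and finite certificates, flag-free. THIS FILE composes the two,
so that every per-pair flag-free conclusion of the lane on N2 is stated MODULO THE CORE:

* `bsdp_three_of_core_of_shaAn_unit_onClassX10b` — **N2, both ranks, `ord₃ #Ш_an = 0`**: the two
  construction facts ∧ the core ∧ `hcertA` ∧ `hunit` ∧ (Schneider at the rank-`1` pairs) ∧ PUBLISHED
  facts (Kato 17.4 (2), PR/BMS/MST odd, modularity, GZK, the period unit at `3`) ⟹ `BSDp W 3`;
* `mazurMainConjecture_three_rankZero_of_core_of_bsdp` — **N2 ∩ {r = 0}, per pair with `BSD(E,3)`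
  booked**: the same inputs ⟹ X_A3 at the pair (`MazurMainConjecture W 3`) — GEN 35's
  `mazurMainConjecture_three_rankZero_of_katoMuTransferThree_of_bsdp` re-based on the core;
* `MuZeroRoad.bsdp_three_of_ainvs_of_core_of_shaAn_unit` — the literal-model RECORD shape (either image).

READING for N2 (evidence, no label moves): per pair and flag-free, the residue of `BSD(E,3)` on the 292
`3 ∤ #Ш_an` cells and of X_A3 on the 274 certificate-closed rank-`0` cells is now, in the kernel,
EXACTLY {`CoreTheoremAOnClassX10b` (the cell theorem of `bsd-smallim` on paper, being formalised for X9
as `stub_coreX9`), Kato's two construction facts (PUB), the two-engine `μ^an = 0` certificate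
(313/313 of record, `class-closure/N2/MUCERT3-x10g36.tsv`), the booked `BSD(E,3)` or `3 ∤ #Ш_an`,
the Schneider certificate at `r = 1`}. Where `3` enters: only through `p = 3` / `ClassX10`.

References: [Kato2004Asterisque] Thm. 12.6 (p. 222), (14.9.3), §17.13 (pp. 279–280), Thm. 17.4 (2)
(p. 273); [GreenbergVatsal2000] Prop. 3.7; [GreenbergLNM1716] Conj. 1.11, Thm. 4.1; [PerrinRiou1987]
§1.4 Cor. 1.8; [BalakrishnanMullerStein2015] Thm. 1.7; [Mazur1978] Prop. 6.3 (1); [Miller2011LMS]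
Def. 1.1; cell files X10-AUDIT.md §42.
-/

set_option autoImplicit false

noncomputable section

open scoped Classical MatrixGroups ModularForm

open CongruenceSubgroup WeierstrassCurve Literature.NumberTheory.EllipticCurves
  Literature.NumberTheory.EllipticCurves.ModularForms Literature.NumberTheory.EllipticCurves.Rank1Residual
  Literature.NumberTheory.EllipticCurves.Rank1Residual.Typed
  Literature.NumberTheory.EllipticCurves.Wuthrich2014
  Literature.NumberTheory.EllipticCurves.Kato2004
  Literature.NumberTheory.EllipticCurves.Rank1Residual.X11RankOneCertificates
  Summit.BirchSwinnertonDyer.BirchSwinnertonDyer.Rank1Residual.IntModel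
  Summit.BirchSwinnertonDyer.BirchSwinnertonDyer.Rank1Residual.X11RankOne
  Summit.BirchSwinnertonDyer.BirchSwinnertonDyer.Theorems.Rank1ResidualX1Defs
  Summit.BirchSwinnertonDyer.BirchSwinnertonDyer.Rank1Residual

namespace Summit.BirchSwinnertonDyer.Rank1Residual.X10

section PerPair

variable (W : WeierstrassCurve ℚ) [W.IsElliptic] [W.IsGloballyMinimal]

/-- **N2 (BOTH ranks) at a pair with `ord₃ #Ш(E/ℚ)_an = 0`, THROUGH THE CORE: Kato's two construction
facts (`hne`, `hfine`; PUBLISHED, Kato 2004 §12.2 / Thm. 12.6 + (14.9.3)/(17.13.1)) ∧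
`CoreTheoremAOnClassX10b` ∧ the finite certificates (`hcertA` unit coefficient, `hunit` `3 ∤ #Ш_an`,
`hSch` Schneider at the rank-`1` pairs) ∧ PUBLISHED facts (`hK` Kato 17.4 (2), `hS`, `hPR`, `hMT`,
`hmodP`, `hGZK`, `h3`) ⟹ Miller's `BSD(E,3)`.** `katoMuTransferThree_of_core` into
`bsdp_three_of_katoMuTransferThree_of_shaAn_unit_onClassX10b`. No rational main conjecture, no flag;
nothing booked. [cite: Kato2004Asterisque, Thm. 12.6 (p. 222), §17.13 (pp. 279–280) and Thm. 17.4 (2) (p. 273)]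
[cite: PerrinRiou1987, §1.4 Cor. 1.8] [cite: Miller2011LMS, Def. 1.1 (arXiv:1010.2431 p. 3)] -/
theorem bsdp_three_of_core_of_shaAn_unit_onClassX10b
    (hne : nonempty_iwasawaH1Data) (hfine : exists_divisibilityInputs_fineQuotient_zeta)
    (hcore : CoreTheoremAOnClassX10b)
    (hS : Schneider1985_order_charGenerator_odd) (hPR : perrinRiou_rankOne_leadingTerms_odd)
    (hMT : mazur_tate_sigma_exists_odd) (hmodP : nonempty_modularParametrizationData)
    (hGZK : rank_eq_analyticRank_of_analyticRank_le_one)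
    (h3 : realPeriodRat_eq_unit_mul_plusPeriod_three)
    (hK : ∀ (κ : ZpExtension ℚ 3) (γ : Field.absoluteGaloisGroup ℚ) [NeZero (W.conductorNorm ℤ)]
      (f : CuspForm (Gamma0 (W.conductorNorm ℤ)) 2), kato_divisibility W 3 (κ := κ) (γ := γ) (f := f))
    (hX : ClassX10 W 3) (hns : ¬ Surj W 3)
    (hSch : W.analyticRank = 1 → ∀ Dh : PAdicHeightData W 3, Dh.IsCanonical → SchneiderConjecture Dh)
    (hcertA : ∀ {N : ℕ} [NeZero N] (f : CuspForm (Gamma0 N) 2), IsNewformOf W f →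
      ∃ n : ℕ, ‖PowerSeries.coeff n (padicLFunction f (unitRoot W 3 : ℚ_[3]))‖ = 1)
    (hunit : ∃ q : ℚ, shaAn W = (q : ℂ) ∧ padicValRat 3 q = 0) : BSDp W 3 :=
  bsdp_three_of_katoMuTransferThree_of_shaAn_unit_onClassX10b W hS hPR hMT hmodP hGZK h3
    (katoMuTransferThree_of_core hne hfine hcore) hK hX hns hSch hcertA hunit

/-- **N2 ∩ {r = 0}, per pair with `BSD(E,3)` booked, THROUGH THE CORE: the two construction facts ∧
`CoreTheoremAOnClassX10b` ∧ `hcertA` ∧ `hbsd` ∧ PUBLISHED facts ⟹ X_A3 at the pair,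
`MazurMainConjecture W 3`.** GEN 35's `mazurMainConjecture_three_rankZero_of_katoMuTransferThree_of_bsdp`
with the transfer supplied by `katoMuTransferThree_of_core`. Flag-free; nothing booked.
[cite: Kato2004Asterisque, Thm. 12.6 (p. 222), §17.13 (pp. 279–280) and Thm. 17.4 (2) (p. 273)]
[cite: GreenbergLNM1716, §1 Conj. 1.11 and §5] [cite: Miller2011LMS, Def. 1.1 (arXiv:1010.2431 p. 3)] -/
theorem mazurMainConjecture_three_rankZero_of_core_of_bsdp
    (hne : nonempty_iwasawaH1Data) (hfine : exists_divisibilityInputs_fineQuotient_zeta)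
    (hcore : CoreTheoremAOnClassX10b)
    (hS : Schneider1985_order_charGenerator_odd) (hMT : mazur_tate_sigma_exists_odd)
    (hmodP : nonempty_modularParametrizationData)
    (hGZK : rank_eq_analyticRank_of_analyticRank_le_one)
    (h3 : realPeriodRat_eq_unit_mul_plusPeriod_three)
    (hK : ∀ (κ : ZpExtension ℚ 3) (γ : Field.absoluteGaloisGroup ℚ) [NeZero (W.conductorNorm ℤ)]
      (f : CuspForm (Gamma0 (W.conductorNorm ℤ)) 2), kato_divisibility W 3 (κ := κ) (γ := γ) (f := f))
    (hX : ClassX10 W 3) (hns : ¬ Surj W 3) (hr0 : W.analyticRank = 0)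
    (hcertA : ∀ {N : ℕ} [NeZero N] (f : CuspForm (Gamma0 N) 2), IsNewformOf W f →
      ∃ n : ℕ, ‖PowerSeries.coeff n (padicLFunction f (unitRoot W 3 : ℚ_[3]))‖ = 1)
    (hbsd : BSDp W 3) : MazurMainConjecture W 3 :=
  mazurMainConjecture_three_rankZero_of_katoMuTransferThree_of_bsdp W hS hMT hmodP hGZK h3
    (katoMuTransferThree_of_core hne hfine hcore) hK hX hns hr0 hcertA hbsd

end PerPair

/-! ### The literal-model RECORD shape through the core -/

namespace MuZeroRoad

/-- **Through the core, for a cell given by a literal integer model** `[a1,a2,a3,a4,a6]`: the two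
construction facts ∧ `CoreTheoremAOnClassX10b` ∧ `hcertA` ∧ `hunit` ∧ `hL` ∧ PUBLISHED facts ⟹
Miller's `BSD(E,3)` (good ordinary `3` and `E[3]` irreducible read off the model by the cell's
`decide`-able certificates; EITHER image). `bsdp_three_of_ainvs_of_katoMuTransferThree_of_shaAn_unit`
with the transfer from `katoMuTransferThree_of_core`. Per pair; nothing booked.
[cite: Kato2004Asterisque, Thm. 12.6 (p. 222), §17.13 (pp. 279–280) and Thm. 17.4 (2), (3) (p. 273)]
[cite: Mazur1978, §6 Prop. 6.3 (1) (p. 153)] [cite: Miller2011LMS, Def. 1.1 (arXiv:1010.2431 p. 3)] -/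
theorem bsdp_three_of_ainvs_of_core_of_shaAn_unit
    (hne : nonempty_iwasawaH1Data) (hfine : exists_divisibilityInputs_fineQuotient_zeta)
    (hcore : CoreTheoremAOnClassX10b)
    (hkato : ∀ (W : WeierstrassCurve ℚ) [W.IsElliptic] [W.IsGloballyMinimal] (p : ℕ) [Fact p.Prime]
      (κ : ZpExtension ℚ p) (γ : Field.absoluteGaloisGroup ℚ) (N : ℕ) [NeZero N]
      (f : CuspForm (Gamma0 N) 2), kato_divisibility W p (κ := κ) (γ := γ) (f := f))
    (hS : Schneider1985_order_charGenerator_odd) (hMT : mazur_tate_sigma_exists_odd)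
    (hmodP : nonempty_modularParametrizationData)
    (hGZK : rank_eq_analyticRank_of_analyticRank_le_one)
    (h3 : realPeriodRat_eq_unit_mul_plusPeriod_three)
    (a1 a2 a3 a4 a6 : ℤ) {W : WeierstrassCurve ℚ} [W.IsElliptic] [W.IsGloballyMinimal]
    (hW : integralModelInt W = ⟨a1, a2, a3, a4, a6⟩)
    [Fact (Nat.Prime 3)] (ℓ n n3 : ℕ) [Fact ℓ.Prime]
    (h3Δ : ¬ (3 : ℤ) ∣ discOf [a1, a2, a3, a4, a6])
    (hc3 : countPoints [a1, a2, a3, a4, a6] 3 = n3) (hord3 : ¬ (3 : ℤ) ∣ (3 : ℤ) + 1 - n3)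
    (hℓ2 : ℓ ≠ 2) (hℓ3 : ℓ ≠ 3) (hℓΔ : ¬ (ℓ : ℤ) ∣ discOf [a1, a2, a3, a4, a6])
    (hc : countPoints [a1, a2, a3, a4, a6] ℓ = n)
    (hnoroot : ∀ t : ℕ, t < 3 → ¬ (3 : ℤ) ∣ (t : ℤ) ^ 2 - ((ℓ : ℤ) + 1 - n) * t + ℓ)
    (hL : W.entireLFunction 1 ≠ 0)
    (hcertA : ∀ {N : ℕ} [NeZero N] (f : CuspForm (Gamma0 N) 2), IsNewformOf W f →
      ∃ n : ℕ, ‖PowerSeries.coeff n (padicLFunction f (unitRoot W 3 : ℚ_[3]))‖ = 1)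
    (hunit : ∃ q : ℚ, shaAn W = (q : ℂ) ∧ padicValRat 3 q = 0) : BSDp W 3 :=
  bsdp_three_of_ainvs_of_katoMuTransferThree_of_shaAn_unit hkato hS hMT hmodP hGZK h3
    (katoMuTransferThree_of_core hne hfine hcore) a1 a2 a3 a4 a6 hW ℓ n n3 h3Δ hc3 hord3 hℓ2 hℓ3 hℓΔ hc
    hnoroot hL hcertA hunit

end MuZeroRoad

end Summit.BirchSwinnertonDyer.Rank1Residual.X10

end
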